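import Literature.Probability.Percolation.FourArmGarbanSeparationReduction
import Literature.Probability.LatticeModels.DartFlux
import HarnessLib

/-!
# Garban's crossing variable is increasing: the interface reaches `∂₂Q` iff `Q` is crossed

Topic `Literature/Probability/Percolation`; support file for the named fact
`Garban2011_fourArm_multiscale` (`FourArmGarban.lean`; C. Garban, Appendix B of O. Schramm,
S. Smirnov, Ann. Probab. 39 (2011), Lemma B.1). Bond percolation on `ℤ²`.

In `FourArmGarbanSeparationReduction.lean` Garban's crossing variable `X = 2·1_{Q crossed} - 1`
is rendered through the interface: `crossingSign n hn = 2·1_T - 1` with `T` the event that the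
medial exploration `γ` of the square `{0, …, 4n}²` (wired left side `∂₀Q`) arrives at an edge
touching the right side `∂₂Q = {x₀ = 4n}`. The remaining hypothesis of
`Garban2011_fourArm_multiscale_of_separation'` (Garban's (B.2)+(B.4)) is a statement about
pivotality of the squares `Q_j` FOR `X`, whose proof in the source ("`Q_j` is pivotal for `X` if
and only if there are two open arms [...] and two dual closed arms", the conditional FKG step
"the event `{C_j = 1}` is increasing") uses throughout that `X` is an increasing function of the
configuration. This file proves that for the interface rendering, by identifying `T` with a
crossing event:

* `exists_bcOpen_walk_to_zdArcA'`, `exists_faceWalk_bcClosed` — for any admissible domain: the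
  left vertices of the orbit (which avoid the dual-wired arc, `cornerOrbit_fst_not_mem_zdArcB`,
  `DartFlux.lean`) chain to the wired arc through edges open in the completed configuration; the faces of the orbit chain through dual edges crossing edges CLOSED in the
  completed configuration (Smirnov 2001, §2);
* `squareReach L` — **`Q` is crossed**: a walk of the square from the left column `{x₀ = 0}` to
  the column `{x₀ = L - 1}` next to the right side, all of whose edges are open in the completed
  configuration (an increasing event, `squareReach_mono`);
* `reveals_rightColumn_iff_squareReach` — **`γ` reaches `∂₂Q` iff `Q` is crossed** (for the
  square `squareDobrushin L`, `L ≥ 2`): "⇒" by the left chain; "⇐" by the discrete Jordan curve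
  theorem of `PlanarDuality.lean` (`exists_dart_sepEdge_mem_edges`): if `γ` never reaches the
  right side, its right faces, from the face above the top-left edge `e_b` down to the face below
  the bottom-left edge `e_a`, form a top-bottom dual crossing of `[0, L-2] × [-1, L]` through
  closed edges, which every left-right open crossing of `[0, L-1] × [0, L]` must cross;
* `monotone_crossingSign` — hence **`crossingSign n hn` is monotone** in the configuration.

## References

* O. Schramm, S. Smirnov (appendix by C. Garban), Ann. Probab. 39 (2011), Appendix B, proof of
  Lemma B.1 [SchrammSmirnov2011].
* S. Smirnov, C. R. Acad. Sci. Paris 333 (2001), §2 (the exploration process) [Smirnov2001].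
* B. Bollobás, O. Riordan, *Percolation* (2006), Ch. 3, Lemma 1 (rectangle duality)
  [BollobasRiordan2006].

Tree: `cornerOrbit`, `cornerOrbit_inv`, `cSrc_cornerOrbit_succ`, `nextCorner_of_mem`,
`nextCorner_of_not_mem`, `cFace_nextCorner_of_mem`, `cFace_nextCorner_of_not_mem`,
`cTgt_exit_mem_zdABEdges`, `cTgt_exit_ne_cSrc_start`, `existsUnique_startCorner`,
`not_mem_bcBondConfig_of_mem_zdArcB` (`MedialInterfaceProofs.lean`),
`cornerOrbit_fst_not_mem_zdArcB` (`DartFlux.lean`),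
`startCorner`, `isStartCorner_startCorner`, `exitTime`, `exitTime_pos`,
`not_isInnerFace_exitTime`, `isInnerFace_of_lt_exitTime` (`FermionicObservableSums.lean`),
`exploredEdge` (`FKExplorationDomainMarkov.lean`), `dualEdge_cTgt`, `isCorner_cFace_of_mem_cSrc`,
`Reveals` (`FourArmGarbanRevealment.lean`), `exists_dart_sepEdge_mem_edges`, `dualEdge_sepEdge`
(`PlanarDuality.lean`), `squareDobrushin`, `isInnerFace_squareDobrushin_iff`,
`mem_zdArcA_squareDobrushin_iff`, `mem_zdArcB_squareDobrushin_iff`, `zdABEdges_squareDobrushin`,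
`face_of_isCorner_pt`, `meshDomain_squareDomain` (`FourArmGarbanSquareDomain.lean`),
`rightColumnPairs`, `crossingSign`, `isZdAdmissible_square`
(`FourArmGarbanSeparationReduction.lean`).
-/

noncomputable section

namespace Literature.Probability.Percolation

open _root_.MeasureTheory Set LatticeModels LatticeModels.DiscreteDobrushin

variable {D : DiscreteDobrushin}

/-! ### The orbit of an admissible domain: left vertices, faces -/

/-- One step of the left chain in the completed configuration. [cite: Smirnov2001, §2] -/
theorem bcOpen_chain_step {ω : BondConfig (Site 2)} {c : Site 2 × Fin 4} {w : Site 2}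
    (p : (zdGraph 2).Walk c.1 w) (hw : w ∈ D.zdArcA) (hp : ∀ e ∈ p.edges, e ∈ D.bcBondConfig ω)
    {S : Set (Site 2)} (hs : ∀ z ∈ p.support, z ∈ S) :
    ∃ (w' : Site 2) (p' : (zdGraph 2).Walk (nextCorner (D.bcBondConfig ω) c).1 w'),
      w' ∈ D.zdArcA ∧ (∀ e ∈ p'.edges, e ∈ D.bcBondConfig ω) ∧
      ∀ z ∈ p'.support, z ∈ S ∨ z = (nextCorner (D.bcBondConfig ω) c).1 := by
  by_cases h : cTgt c ∈ D.bcBondConfig ω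
  · rw [nextCorner_of_mem h]
    by_cases hA : c.1 + cornerUnit (c.2 + 1) ∈ D.zdArcA
    · refine ⟨_, SimpleGraph.Walk.nil, hA, by simp, fun z hz => ?_⟩
      rw [SimpleGraph.Walk.support_nil, List.mem_singleton] at hz
      exact Or.inr hz
    · have hadj : (zdGraph 2).Adj (c.1 + cornerUnit (c.2 + 1)) c.1 :=
        (adj_zdGraph_of_mem_bcBondConfig h).symm
      refine ⟨w, SimpleGraph.Walk.cons hadj p, hw, fun e he => ?_, fun z hz => ?_⟩
      · rw [SimpleGraph.Walk.edges_cons, List.mem_cons] at he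
        rcases he with rfl | he
        · rw [Sym2.eq_swap]; exact h
        · exact hp e he
      · rw [SimpleGraph.Walk.support_cons, List.mem_cons] at hz
        rcases hz with rfl | hz
        · exact Or.inr rfl
        · exact Or.inl (hs z hz)
  · rw [nextCorner_of_not_mem h]
    exact ⟨w, p, hw, hp, fun z hz => Or.inl (hs z hz)⟩

/-- **Open edges on the left, completed-configuration form**: the left vertex of the `n`-th
corner is joined to the wired arc by a walk whose edges are open in the completed configuration
and whose vertices are left vertices of earlier corners or sites of the wired arc.
[cite: Smirnov2001, §2] -/
theorem exists_bcOpen_walk_to_zdArcA' (hD : D.IsZdAdmissible) (ω : BondConfig (Site 2)) (n : ℕ) :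
    ∃ (w : Site 2) (p : (zdGraph 2).Walk (cornerOrbit (D.bcBondConfig ω) (startCorner hD) n).1 w),
      w ∈ D.zdArcA ∧ (∀ e ∈ p.edges, e ∈ D.bcBondConfig ω) ∧
      ∀ z ∈ p.support, z ∈ D.zdArcA ∨
        ∃ k ≤ n, z = (cornerOrbit (D.bcBondConfig ω) (startCorner hD) k).1 := by
  induction n with
  | zero =>
    refine ⟨_, SimpleGraph.Walk.nil, (isStartCorner_startCorner hD).mem_zdArcA, by simp, fun z hz => ?_⟩
    rw [SimpleGraph.Walk.support_nil, List.mem_singleton] at hz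
    exact Or.inr ⟨0, le_rfl, hz⟩
  | succ n ih =>
    obtain ⟨w, p, hw, hp, hs⟩ := ih
    obtain ⟨w', p', hw', hp', hs'⟩ := bcOpen_chain_step p hw hp hs
    refine ⟨w', p', hw', hp', fun z hz => ?_⟩
    rcases hs' z hz with (h | ⟨k, hk, h⟩) | h
    · exact Or.inl h
    · exact Or.inr ⟨k, by omega, h⟩
    · exact Or.inr ⟨n + 1, le_rfl, h⟩

/-- One step of the right face chain in the completed configuration. [cite: Smirnov2001, §2] -/
theorem faceWalk_step {ω : BondConfig (Site 2)} {c : Site 2 × Fin 4} {f₀ : Site 2}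
    (q : (zdGraph 2).Walk (cFace c) f₀) {P : Sym2 (Site 2) → Prop} {S : Set (Site 2)}
    (hq : ∀ e' ∈ q.edges, P e') (hs : ∀ z ∈ q.support, z ∈ S) :
    ∃ q' : (zdGraph 2).Walk (cFace (nextCorner (D.bcBondConfig ω) c)) f₀,
      (∀ e' ∈ q'.edges, P e' ∨ (cTgt c ∉ D.bcBondConfig ω ∧ dualEdge (cTgt c) = e')) ∧
      ∀ z ∈ q'.support, z ∈ S ∨ z = cFace (nextCorner (D.bcBondConfig ω) c) := by
  by_cases h : cTgt c ∈ D.bcBondConfig ω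
  · rw [cFace_nextCorner_of_mem h]
    exact ⟨q, fun e' he' => Or.inl (hq e' he'), fun z hz => Or.inl (hs z hz)⟩
  · rw [cFace_nextCorner_of_not_mem h]
    have hdual : dualEdge (cTgt c) = s(cFace c, faceAt c.1 (c.2 + 1)) := dualEdge_cTgt c
    have hadj : (zdGraph 2).Adj (faceAt c.1 (c.2 + 1)) (cFace c) := by
      have hE : dualEdge (cTgt c) ∈ (zdGraph 2).edgeSet :=
        dualEdge_mem_edgeSet_holds (cTgt_mem_edgeSet c)
      rw [hdual] at hE
      exact ((SimpleGraph.mem_edgeSet (zdGraph 2)).1 hE).symm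
    refine ⟨SimpleGraph.Walk.cons hadj q, fun e' he' => ?_, fun z hz => ?_⟩
    · rw [SimpleGraph.Walk.edges_cons, List.mem_cons] at he'
      rcases he' with rfl | he'
      · exact Or.inr ⟨h, by rw [hdual, Sym2.eq_swap]⟩
      · exact Or.inl (hq e' he')
    · rw [SimpleGraph.Walk.support_cons, List.mem_cons] at hz
      rcases hz with rfl | hz
      · exact Or.inr rfl
      · exact Or.inl (hs z hz)

/-- **Dual-open edges on the right, completed-configuration form**: the face of the `n`-th corner
is joined to the face of the start corner by a walk of faces each of whose steps is the dual of an
explored edge of time `< n` CLOSED in the completed configuration, through faces of the corners of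
times `≤ n`. [cite: Smirnov2001, §2] -/
theorem exists_faceWalk_bcClosed (hD : D.IsZdAdmissible) (ω : BondConfig (Site 2)) (n : ℕ) :
    ∃ q : (zdGraph 2).Walk (cFace (cornerOrbit (D.bcBondConfig ω) (startCorner hD) n))
        (cFace (startCorner hD)),
      (∀ e' ∈ q.edges, ∃ k < n,
        cTgt (cornerOrbit (D.bcBondConfig ω) (startCorner hD) k) ∉ D.bcBondConfig ω ∧
        dualEdge (cTgt (cornerOrbit (D.bcBondConfig ω) (startCorner hD) k)) = e') ∧
      ∀ z ∈ q.support, ∃ k ≤ n, z = cFace (cornerOrbit (D.bcBondConfig ω) (startCorner hD) k) := by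
  induction n with
  | zero =>
    show ∃ q : (zdGraph 2).Walk (cFace (startCorner hD)) (cFace (startCorner hD)), _
    refine ⟨SimpleGraph.Walk.nil, fun e' he' => ?_, fun z hz => ?_⟩
    · exact absurd (show e' ∈ ([] : List (Sym2 (Site 2))) from he') (by simp)
    · exact ⟨0, le_rfl, List.mem_singleton.1 (show z ∈ [cFace (startCorner hD)] from hz)⟩
  | succ n ih =>
    obtain ⟨q, hq, hs⟩ := ih
    obtain ⟨q', hq', hs'⟩ := faceWalk_step q hq hs
    refine ⟨q', fun e' he' => ?_, fun z hz => ?_⟩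
    · rcases hq' e' he' with ⟨k, hk, h⟩ | h
      · exact ⟨k, by omega, h⟩
      · exact ⟨n, Nat.lt_succ_self n, h⟩
    · rcases hs' z hz with ⟨k, hk, h⟩ | h
      · exact ⟨k, by omega, h⟩
      · exact ⟨n + 1, le_rfl, h⟩

/-! ### The square: start corner, exit face -/

/-- The pairs of sites touching the column `{x₀ = L}` (for Garban's square `{0, …, 4n}²`,
`rightColumnPairs n = rightPairs (4n)`). [folklore] -/
def rightPairs (L : ℕ) : Set (Sym2 (Site 2)) := {e | ∃ x ∈ e, x 0 = (L : ℤ)}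

/-- `rightColumnPairs n` is `rightPairs (4n)`. [folklore] -/
theorem rightColumnPairs_eq (n : ℕ) : rightColumnPairs n = rightPairs (4 * n) := rfl

/-- `cornerUnit 0 = e₀`. [folklore] -/
theorem cornerUnit_zero : cornerUnit 0 = Pi.single 0 1 := rfl

/-- `cornerOff 0 = 0`, `cornerOff 3 = e₁`, and the first coordinates of `cornerOff 1`, `cornerOff 2`
are `1`. [folklore] -/
theorem cornerOff_apply_zero (k : Fin 4) : cornerOff k 0 = if k = 0 ∨ k = 3 then 0 else 1 := by
  fin_cases k <;> rfl

/-- `faceAt v 0 = v`. [folklore] -/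
theorem faceAt_zero (v : Site 2) : faceAt v 0 = v := by
  show v - cornerOff 0 = v
  have : cornerOff 0 = 0 := rfl
  rw [this, sub_zero]

/-- `faceAt v 3 = v - e₁`. [folklore] -/
theorem faceAt_three (v : Site 2) : faceAt v 3 = v - Pi.single 1 1 := rfl

/-- `(0,0) - e₁ = (0,-1)`. [folklore] -/
theorem pt_zero_zero_sub : pt 0 0 - Pi.single 1 1 = pt 0 (-1) := by
  rw [sub_eq_iff_eq_add, ← pt_succ_eq']; norm_num

/-- **The start corner of the square** is the corner of the bottom-left face at `(0,0)` sourced at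
the bottom-left `A`–`B` edge `e_a = {(0,0),(1,0)}` (uniqueness of the start corner). [folklore] -/
theorem startCorner_squareDobrushin {L : ℕ} (hL : 2 ≤ L) :
    startCorner (isZdAdmissible_squareDobrushin hL) = (pt 0 0, 0) := by
  have hD := isZdAdmissible_squareDobrushin hL
  have hspec := isStartCorner_startCorner hD
  refine (existsUnique_startCorner hD).unique ⟨hspec.mem_zdArcA, hspec.mem_zdArcB, hspec.isOutEdge⟩
    ⟨?_, ?_, ?_⟩
  · rw [mem_zdArcA_squareDobrushin_iff (by omega), pt_mem_squareSites_iff]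
    exact ⟨by omega, rfl⟩
  · rw [cornerUnit_zero, ← pt_succ_eq, mem_zdArcB_squareDobrushin_iff (by omega), pt_mem_squareSites_iff]
    norm_num; omega
  · constructor
    · rw [faceAt_zero, isInnerFace_squareDobrushin_iff, Fin.forall_fin_two]
      simp only [pt_apply_zero, pt_apply_one]; omega
    · show ¬(squareDobrushin L).IsInnerFace (faceAt (pt 0 0) (0 + 3))
      rw [show (0 : Fin 4) + 3 = 3 from rfl, faceAt_three, pt_zero_zero_sub, isInnerFace_squareDobrushin_iff,
        not_forall]
      exact ⟨1, by simp⟩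

/-- The face of the start corner of the square is the bottom-left face `(0,0)`. [folklore] -/
theorem cFace_startCorner_squareDobrushin {L : ℕ} (hL : 2 ≤ L) :
    cFace (startCorner (isZdAdmissible_squareDobrushin hL)) = pt 0 0 := by
  rw [startCorner_squareDobrushin hL]; exact faceAt_zero _

/-- The source edge of the start corner of the square is `e_a = {(0,0),(1,0)}`. [folklore] -/
theorem cSrc_startCorner_squareDobrushin {L : ℕ} (hL : 2 ≤ L) :
    cSrc (startCorner (isZdAdmissible_squareDobrushin hL)) = s(pt 0 0, pt 1 0) := by
  rw [startCorner_squareDobrushin hL, cSrc, cornerUnit_zero, ← pt_succ_eq]; norm_num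

/-- **The exit face of the square** is the face `(0, L)` above the top-left `A`–`B` edge
`e_b = {(0,L),(1,L)}`: the last explored edge is an `A`–`B` edge other than `e_a`, and the exit
face contains it and is not inner. [folklore] -/
theorem cFace_exit_squareDobrushin {L : ℕ} (hL : 2 ≤ L) (ω : BondConfig (Site 2)) :
    cFace (cornerOrbit ((squareDobrushin L).bcBondConfig ω) (startCorner (isZdAdmissible_squareDobrushin hL))
      (exitTime (isZdAdmissible_squareDobrushin hL) ω)) = pt 0 L := by
  set hD := isZdAdmissible_squareDobrushin hL
  set N := exitTime hD ω with hN
  obtain ⟨N', hN'⟩ : ∃ N', N = N' + 1 := ⟨N - 1, (Nat.sub_add_cancel (exitTime_pos hD ω)).symm⟩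
  have hin : (squareDobrushin L).IsInnerFace
      (cFace (cornerOrbit ((squareDobrushin L).bcBondConfig ω) (startCorner hD) N')) :=
    isInnerFace_of_lt_exitTime hD ω (by omega)
  have hout : ¬ (squareDobrushin L).IsInnerFace
      (cFace (cornerOrbit ((squareDobrushin L).bcBondConfig ω) (startCorner hD) (N' + 1))) := by
    rw [← hN']; exact not_isInnerFace_exitTime hD ω
  have hAB := cTgt_exit_mem_zdABEdges hD (isStartCorner_startCorner hD) hin hout
  have hne := cTgt_exit_ne_cSrc_start hD (isStartCorner_startCorner hD) hin hout
  rw [zdABEdges_squareDobrushin hL, Set.mem_insert_iff, Set.mem_singleton_iff] at hAB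
  rw [cSrc_startCorner_squareDobrushin hL] at hne
  have heb : cTgt (cornerOrbit ((squareDobrushin L).bcBondConfig ω) (startCorner hD) N') = s(pt 0 L, pt 1 L) :=
    hAB.resolve_left hne
  -- the exit face contains `e_b`
  have hsrc : cSrc (cornerOrbit ((squareDobrushin L).bcBondConfig ω) (startCorner hD) (N' + 1)) = s(pt 0 L, pt 1 L) := by
    rw [cSrc_cornerOrbit_succ, heb]
  rw [hN']
  set f := cFace (cornerOrbit ((squareDobrushin L).bcBondConfig ω) (startCorner hD) (N' + 1)) with hf
  have h0 : IsCorner (pt 0 L) f := isCorner_cFace_of_mem_cSrc (by rw [hsrc]; exact Sym2.mem_mk_left _ _)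
  have h1 : IsCorner (pt 1 L) f := isCorner_cFace_of_mem_cSrc (by rw [hsrc]; exact Sym2.mem_mk_right _ _)
  rcases face_of_isCorner_pt h0 h1 with h | h
  · exact h
  · exfalso
    apply hout
    rw [h, isInnerFace_squareDobrushin_iff, Fin.forall_fin_two]
    simp only [pt_apply_zero, pt_apply_one]; omega

/-! ### If the interface never reaches the right side, its faces stay in `{x₀ ≤ L - 2}` -/

/-- Left vertices of corners with inner face lie in the square and off the right column.
[folklore] -/
theorem fst_mem_squareSites_of_lt_exitTime {L : ℕ} (hL : 2 ≤ L) (ω : BondConfig (Site 2)) {k : ℕ}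
    (hk : k < exitTime (isZdAdmissible_squareDobrushin hL) ω) :
    (cornerOrbit ((squareDobrushin L).bcBondConfig ω) (startCorner (isZdAdmissible_squareDobrushin hL)) k).1 ∈
        squareSites L ∧
      (cornerOrbit ((squareDobrushin L).bcBondConfig ω) (startCorner (isZdAdmissible_squareDobrushin hL)) k).1 0 + 1 ≤ L := by
  set hD := isZdAdmissible_squareDobrushin hL
  have hin := isInnerFace_of_lt_exitTime hD ω hk
  have hv : (cornerOrbit ((squareDobrushin L).bcBondConfig ω) (startCorner hD) k).1 ∈ squareSites L := by
    have := mem_meshDomain_of_isCorner_of_isInnerFace (isCorner_cFace _) hin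
    rwa [squareDobrushin_Ω, squareDobrushin_δ, meshDomain_squareDomain] at this
  refine ⟨hv, ?_⟩
  have hB := cornerOrbit_fst_not_mem_zdArcB hD (isStartCorner_startCorner hD) ω k
  rw [mem_zdArcB_squareDobrushin_iff (by omega)] at hB
  have hv0 := (mem_squareSites_iff.1 hv) 0
  by_contra h
  exact hB ⟨⟨hv, 0, Or.inr (by omega)⟩, by omega⟩

/-- **No right faces on the right column**: if no explored edge of time `< exitTime` touches the
column `{x₀ = L}`, then every face of the orbit before the exit time has `f₀ ≤ L - 2` (a face with
`f₀ = L - 1` has its corner vertex on `{x₀ = L - 1}` and one of its two edges there is horizontal,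
touching the right column, and explored). [folklore] -/
theorem cFace_apply_zero_le_of_not_reveals {L : ℕ} (hL : 2 ≤ L) (ω : BondConfig (Site 2))
    (hT : ∀ i < exitTime (isZdAdmissible_squareDobrushin hL) ω,
      cTgt (cornerOrbit ((squareDobrushin L).bcBondConfig ω) (startCorner (isZdAdmissible_squareDobrushin hL)) i) ∉
        rightPairs L)
    {k : ℕ} (hk : k < exitTime (isZdAdmissible_squareDobrushin hL) ω) :
    cFace (cornerOrbit ((squareDobrushin L).bcBondConfig ω) (startCorner (isZdAdmissible_squareDobrushin hL)) k) 0
      + 2 ≤ L := by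
  set hD := isZdAdmissible_squareDobrushin hL
  have hin := isInnerFace_of_lt_exitTime hD ω hk
  obtain ⟨hvS, hvL⟩ := fst_mem_squareSites_of_lt_exitTime hL ω hk
  set c := cornerOrbit ((squareDobrushin L).bcBondConfig ω) (startCorner hD) k with hc
  have hf := (isInnerFace_squareDobrushin_iff.1 hin) 0
  by_contra hcon
  have hf0 : cFace c 0 + 1 = L := by omega
  -- the corner vertex is on the west side of the face
  have hcorner := isCorner_cFace c 0
  have hv0 : c.1 0 = cFace c 0 := by rcases hcorner with h | h <;> omega
  -- so the corner index is `0` or `3`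
  have hoff : cornerOff c.2 0 = 0 := by
    have : cFace c = c.1 - cornerOff c.2 := rfl
    have := congrFun this 0
    simp only [Pi.sub_apply] at this; omega
  rw [cornerOff_apply_zero] at hoff
  split_ifs at hoff with hj
  · rcases hj with hj | hj
    · -- index `0`: the SOURCE edge is horizontal towards the right column
      rcases Nat.eq_zero_or_pos k with rfl | hkpos
      · -- the start corner is at `(0,0)`, far from the right column
        have h00 : c = (pt 0 0, 0) := startCorner_squareDobrushin hL
        have : c.1 0 = 0 := by rw [h00]; rfl
        omega
      · obtain ⟨k', rfl⟩ : ∃ k', k = k' + 1 := ⟨k - 1, by omega⟩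
        apply hT k' (by omega)
        have hsrc : cSrc c = cTgt (cornerOrbit ((squareDobrushin L).bcBondConfig ω) (startCorner hD) k') :=
          cSrc_cornerOrbit_succ k'
        rw [← hsrc, cSrc, hj, cornerUnit_zero]
        exact ⟨c.1 + Pi.single 0 1, Sym2.mem_mk_right _ _, by simp; omega⟩
    · -- index `3`: the TARGET edge is horizontal towards the right column
      apply hT k hk
      show cTgt c ∈ rightPairs L
      rw [cTgt, hj, show (3 : Fin 4) + 1 = 0 from rfl, cornerUnit_zero]
      exact ⟨c.1 + Pi.single 0 1, Sym2.mem_mk_right _ _, by simp; omega⟩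
  · omega

/-! ### `Q` is crossed -/

/-- **`Q` is crossed** (from the wired side): a walk of sites of the square, off the right column,
from the left column `{x₀ = 0}` to the column `{x₀ = L - 1}`, all of whose edges are open in the
completed configuration (left-column edges wired, edges touching the other sides closed). This is
the crossing event of Garban's `X` for the square with its boundary conditions; it is increasing
in the configuration. [cite: SchrammSmirnov2011, Appendix B, proof of Lemma B.1 (the crossing event of Q)] -/
def squareReach (L : ℕ) (ω : BondConfig (Site 2)) : Prop :=
  ∃ (a b : Site 2) (p : (zdGraph 2).Walk a b), a 0 = 0 ∧ b 0 + 1 = L ∧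
    (∀ z ∈ p.support, z ∈ squareSites L ∧ z 0 + 1 ≤ L) ∧
    ∀ e ∈ p.edges, e ∈ (squareDobrushin L).bcBondConfig ω

/-- `squareReach` is increasing in the configuration. [folklore] -/
theorem squareReach_mono (L : ℕ) {ω ω' : BondConfig (Site 2)} (h : ω ⊆ ω') (hω : squareReach L ω) :
    squareReach L ω' := by
  obtain ⟨a, b, p, ha, hb, hs, he⟩ := hω
  exact ⟨a, b, p, ha, hb, hs, fun e he' => (squareDobrushin L).bcBondConfig_mono h (he e he')⟩

/-- **If the interface reaches the right side, `Q` is crossed** (the left vertex of that corner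
is on `{x₀ = L-1}` and chains to the wired left column through open edges).
[cite: Smirnov2001, §2] -/
theorem squareReach_of_reveals {L : ℕ} (hL : 2 ≤ L) {ω : BondConfig (Site 2)}
    (h : ∃ i < exitTime (isZdAdmissible_squareDobrushin hL) ω,
      cTgt (cornerOrbit ((squareDobrushin L).bcBondConfig ω) (startCorner (isZdAdmissible_squareDobrushin hL)) i) ∈
        rightPairs L) :
    squareReach L ω := by
  set hD := isZdAdmissible_squareDobrushin hL
  obtain ⟨i, hi, x, hx, hx0⟩ := h
  obtain ⟨hvS, hvL⟩ := fst_mem_squareSites_of_lt_exitTime hL ω hi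
  -- the left vertex is on the column `L - 1`
  have hv : (cornerOrbit ((squareDobrushin L).bcBondConfig ω) (startCorner hD) i).1 0 + 1 = L := by
    rcases Sym2.mem_iff.1 hx with rfl | rfl
    · omega
    · have habs : |cornerUnit ((cornerOrbit ((squareDobrushin L).bcBondConfig ω) (startCorner hD) i).2 + 1) 0| ≤ 1 := by
        generalize (cornerOrbit ((squareDobrushin L).bcBondConfig ω) (startCorner hD) i).2 + 1 = j
        fin_cases j <;> simp [cornerUnit]
      simp only [Pi.add_apply] at hx0
      rw [abs_le] at habs
      omega
  obtain ⟨w, p, hw, hp, hs⟩ := exists_bcOpen_walk_to_zdArcA' hD ω i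
  rw [mem_zdArcA_squareDobrushin_iff (by omega)] at hw
  refine ⟨w, _, p.reverse, hw.2, hv, fun z hz => ?_, fun e he => ?_⟩
  · rw [SimpleGraph.Walk.support_reverse, List.mem_reverse] at hz
    rcases hs z hz with hzA | ⟨k, hk, rfl⟩
    · rw [mem_zdArcA_squareDobrushin_iff (by omega)] at hzA
      exact ⟨hzA.1, by rw [hzA.2]; omega⟩
    · exact fst_mem_squareSites_of_lt_exitTime hL ω (lt_of_le_of_lt hk hi)
  · rw [SimpleGraph.Walk.edges_reverse, List.mem_reverse] at he
    exact hp e he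

/-- `dualEdge` of `e_a = {(0,0),(1,0)}` is the dual edge `{(0,-1),(0,0)}` below it. [folklore] -/
theorem dualEdge_ea : dualEdge s(pt 0 0, pt 1 0) = s(pt 0 (-1), pt 0 0) := by
  rw [show pt 1 0 = pt 0 0 + Pi.single 0 1 from by rw [← pt_succ_eq]; norm_num, dualEdge_horizontal]
  congr 1
  rw [sub_eq_iff_eq_add, ← pt_succ_eq']; norm_num

/-- **If `Q` is crossed, the interface reaches the right side** (discrete Jordan curve theorem):
otherwise the faces of the interface, from the exit face `(0, L)` down to the start face `(0, 0)`
and on to the face `(0, -1)` below `e_a`, form a top-bottom dual crossing of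
`[0, L-2] × [-1, L]` through closed edges, which the open left-right crossing of
`[0, L-1] × [0, L]` given by `squareReach` must cross (`exists_dart_sepEdge_mem_edges`).
[cite: BollobasRiordan2006, Ch. 3 Lemma 1] -/
theorem reveals_of_squareReach {L : ℕ} (hL : 2 ≤ L) {ω : BondConfig (Site 2)} (hR : squareReach L ω) :
    ∃ i < exitTime (isZdAdmissible_squareDobrushin hL) ω,
      cTgt (cornerOrbit ((squareDobrushin L).bcBondConfig ω) (startCorner (isZdAdmissible_squareDobrushin hL)) i) ∈
        rightPairs L := by
  by_contra hT
  simp only [not_exists, not_and] at hT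
  set hD := isZdAdmissible_squareDobrushin hL
  set N := exitTime hD ω with hN
  obtain ⟨a, b, P, ha, hb, hPs, hPe⟩ := hR
  -- the face walk from the exit face to the start face, extended below `e_a`
  obtain ⟨q₀, hq, hqs⟩ := exists_faceWalk_bcClosed hD ω N
  set q : (zdGraph 2).Walk (pt 0 (L : ℤ)) (pt 0 0) :=
    q₀.copy (cFace_exit_squareDobrushin hL ω) (cFace_startCorner_squareDobrushin hL) with hqdef
  have hq_edges : q.edges = q₀.edges := SimpleGraph.Walk.edges_copy _ _ _
  have hq_support : q.support = q₀.support := SimpleGraph.Walk.support_copy _ _ _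
  have hadj : (zdGraph 2).Adj (pt 0 0) (pt 0 (-1)) :=
    (LatticeModels.zdGraph_adj_iff _ _).2 ⟨1, Or.inr (by rw [← pt_succ_eq']; norm_num)⟩
  set Q : (zdGraph 2).Walk (pt 0 (L : ℤ)) (pt 0 (-1)) := q.concat hadj with hQ
  -- coordinate bounds
  have hPs' : ∀ z ∈ P.support, 0 ≤ z 0 ∧ z 0 ≤ ((L - 1 : ℕ) : ℤ) ∧ 0 ≤ z 1 ∧ z 1 ≤ (L : ℤ) := by
    intro z hz
    obtain ⟨hzS, hzL⟩ := hPs z hz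
    have h0 := (mem_squareSites_iff.1 hzS) 0
    have h1 := (mem_squareSites_iff.1 hzS) 1
    omega
  have hQs' : ∀ z ∈ Q.support, 0 ≤ z 0 ∧ z 0 + 1 ≤ ((L - 1 : ℕ) : ℤ) ∧ -1 ≤ z 1 ∧ z 1 ≤ (L : ℤ) := by
    intro z hz
    rw [hQ, SimpleGraph.Walk.support_concat, List.mem_append, List.mem_singleton, hq_support] at hz
    rcases hz with hz | rfl
    · obtain ⟨k, hk, rfl⟩ := hqs z hz
      rcases lt_or_eq_of_le hk with hk | rfl
      · have hin := isInnerFace_of_lt_exitTime hD ω hk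
        have h0 := (isInnerFace_squareDobrushin_iff.1 hin) 0
        have h1 := (isInnerFace_squareDobrushin_iff.1 hin) 1
        have h2 := cFace_apply_zero_le_of_not_reveals hL ω hT hk
        omega
      · rw [cFace_exit_squareDobrushin hL ω]
        simp only [pt_apply_zero, pt_apply_one]
        refine ⟨le_rfl, ?_, by omega, le_rfl⟩
        have : ((L - 1 : ℕ) : ℤ) = (L : ℤ) - 1 := by push_cast [Nat.cast_sub (by omega : 1 ≤ L)]; ring
        rw [this]; omega
    · simp only [pt_apply_zero, pt_apply_one]
      refine ⟨le_rfl, ?_, le_rfl, by omega⟩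
      have : ((L - 1 : ℕ) : ℤ) = (L : ℤ) - 1 := by push_cast [Nat.cast_sub (by omega : 1 ≤ L)]; ring
      rw [this]; omega
  obtain ⟨dq, hdq, hsep⟩ := exists_dart_sepEdge_mem_edges (M := L - 1) (N := L) P Q hPs' hQs' ha
    (by omega) rfl rfl
  -- the crossed edge is closed in the completed configuration
  have hedge : s(dq.fst, dq.snd) ∈ Q.edges := by
    rw [SimpleGraph.Walk.edges]; exact List.mem_map.2 ⟨dq, hdq, rfl⟩
  have hclosed : ∃ e : Sym2 (Site 2), e ∉ (squareDobrushin L).bcBondConfig ω ∧ dualEdge e = s(dq.fst, dq.snd) := by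
    rw [hQ, SimpleGraph.Walk.edges_concat, List.concat_eq_append, List.mem_append, List.mem_singleton,
      hq_edges] at hedge
    rcases hedge with hedge | hedge
    · obtain ⟨k, -, hk, hke⟩ := hq _ hedge
      exact ⟨_, hk, hke⟩
    · refine ⟨s(pt 0 0, pt 1 0), not_mem_bcBondConfig_of_mem_zdArcB hD (Sym2.mem_mk_right _ _) ?_, ?_⟩
      · rw [mem_zdArcB_squareDobrushin_iff (by omega), pt_mem_squareSites_iff]
        exact ⟨⟨by omega, 1, Or.inl rfl⟩, by simp⟩
      · rw [hedge, dualEdge_ea, Sym2.eq_swap]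
  obtain ⟨e, heclosed, hedual⟩ := hclosed
  have heq : sepEdge dq.fst dq.snd = e :=
    dualEdge_bijective.1 ((dualEdge_sepEdge dq.adj).trans hedual.symm)
  rw [heq] at hsep
  exact heclosed (hPe e hsep)

/-- **The interface reaches `∂₂Q` iff `Q` is crossed.** [cite: SchrammSmirnov2011, Appendix B, proof of Lemma B.1 (X and the interface γ)] -/
theorem reveals_rightPairs_iff_squareReach {L : ℕ} (hL : 2 ≤ L) (ω : BondConfig (Site 2)) :
    ω ∈ Reveals (isZdAdmissible_squareDobrushin hL) (rightPairs L) ↔ squareReach L ω :=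
  ⟨fun h => squareReach_of_reveals hL h, fun h => reveals_of_squareReach hL h⟩

/-- **Garban's crossing variable is increasing**: `crossingSign n hn = 2·1_{Q crossed} - 1` with the
increasing event `squareReach (4n)`, hence monotone in the configuration.
[cite: SchrammSmirnov2011, Appendix B, proof of Lemma B.1 (X is the indicator of an increasing event)] -/
theorem monotone_crossingSign (n : ℕ) (hn : 1 ≤ n) : Monotone (crossingSign n hn) := by
  intro ω ω' h
  have hL : 2 ≤ 4 * n := by omega
  have key : ∀ ω : BondConfig (Site 2),
      ω ∈ Reveals (isZdAdmissible_square n hn) (rightColumnPairs n) ↔ squareReach (4 * n) ω := fun ω =>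
    reveals_rightPairs_iff_squareReach hL ω
  unfold crossingSign
  have hind : (Reveals (isZdAdmissible_square n hn) (rightColumnPairs n)).indicator (1 : BondConfig (Site 2) → ℝ) ω ≤
      (Reveals (isZdAdmissible_square n hn) (rightColumnPairs n)).indicator 1 ω' := by
    classical
    simp only [Set.indicator_apply, Pi.one_apply]
    by_cases hω : ω ∈ Reveals (isZdAdmissible_square n hn) (rightColumnPairs n)
    · have hω' : ω' ∈ Reveals (isZdAdmissible_square n hn) (rightColumnPairs n) :=
        (key ω').2 (squareReach_mono _ h ((key ω).1 hω))
      rw [if_pos hω, if_pos hω']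
    · rw [if_neg hω]
      split_ifs <;> norm_num
  linarith

end Literature.Probability.Percolation
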